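import Literature.Topology.FourManifolds.LefschetzBasePages
import Mathlib.Analysis.SpecialFunctions.SmoothTransition
import Mathlib.Analysis.SpecialFunctions.Complex.Log
import HarnessLib

/-!
# N3 (`stub_STgeo`) ▸ N3-nat ▸ N3d-1 `node_stabBaseData` ▸ G1a/G1b: THE COMPRESSED POWER
# `stabX g x = x^{(2g+1)/(2g+3)}` (radially corrected) — first half of the fibred genus-raising embedding
(wave 8, brick J6-2a of stub `stub_STgeo` = node N3 of NF4, line `modp-braid-orbits`, crux
`ConvexBisection.AcyclicBisectionExists`, item stmt-SmoothPoincare4-10508; registered sub-goal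
`helper_norm_stabX`; what remains of N3d-1 = `H6Remaining.RemainingN3d1`, report H6 §5: the fibred
1-handle presentation `E` of `Base (g+1)` over `Base g`.)

Milnor's fibre `y² = x^{2g+1} + 1 + w` of genus `g` sits inside the fibre `Y² = X^{2g+3} + 1 + w` of genus
`g + 1` through the ANGULAR COMPRESSION `X = x^{(2g+1)/(2g+3)}` (a branch off the cut `arg x = 0`, the old
gap between the roots `ζ_{2g}` and `ζ_0`), `Y = y`: it preserves `Φ = y² − x^{2g+1}` ON THE NOSE, hence `w`,
sends the old roots `ζ_k` to the new roots `ζ'_k` (`k ≤ 2g`) and misses exactly the sector of the two new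
roots `ζ'_{2g+1}, ζ'_{2g+2}`.  Corrected radially so that `‖X‖ = ‖x‖` on the binding region `‖x‖² ≥ 4` (where
`rho` sees `‖x‖`), its first coordinate is the map of this file:

* §1 `logCut x = log (−x) + πi` (the logarithm cut along `[0, ∞)`, `Im ∈ (0, 2π)` off the cut);
* §2 the radial profile `radProfile s = χ(s − 3) · log s` (`χ` = `Real.smoothTransition`): `0` for `s ≤ 3`,
  `log s` for `s ≥ 4`, between `0` and `log s`, monotone;
* §3 `stabX g x = exp (κ · logCut x + radProfile ‖x‖² / (2g+3))`, `κ = (2g+1)/(2g+3)`: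
  `stabX ^ (2g+3) = e^{radProfile ‖x‖²} · x^{2g+1}` (`stabX_pow`), `‖stabX x‖ = ‖x‖` for `‖x‖² ≥ 4`
  (registered `helper_norm_stabX`), `‖stabX x‖ < 2` for `‖x‖ < 2`, `eta ‖stabX x‖² = eta ‖x‖²`, strictly
  increasing modulus, **injective off the cut** (`stabX_injOn`).

The second coordinate, the map `stabEmb` of `ℂ²` and the map of the base are in `…StabBaseCutMap.lean`.
Definitions + proved lemmas; no named facts, no `sorry`.  References: J. Milnor, *Singular points of
complex hypersurfaces* (1968), §9 [Milnor1968]; J. B. Etnyre, T. Fuller, IMRN 2006, §2 [EtnyreFuller2006].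
-/

noncomputable section

-- the prescribed namespace `Summit.<P>.<Sub>.…` duplicates `SmoothPoincare4` (P = Sub)
set_option linter.dupNamespace false

open scoped Topology Real
open Set Function Metric
open Literature.Topology.FourManifolds Literature.Topology.FourManifolds.LefschetzBase

namespace Summit.SmoothPoincare4.SmoothPoincare4.Theorems.AcyclicBisectionExists.ModpBraidOrbits

namespace StabBase

variable {g : ℕ}

/-! ## §1 The logarithm cut along `[0, ∞)` -/

/-- **The logarithm with cut along the positive real axis**: `logCut x = log (−x) + πi`, a branch of
`log x` on `ℂ ∖ [0, ∞)` with imaginary part in `(0, 2π)`. [folklore] -/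
def logCut (x : ℂ) : ℂ := Complex.log (-x) + π * Complex.I

/-- `exp (logCut x) = x` for `x ≠ 0`. [folklore] -/
theorem exp_logCut {x : ℂ} (hx : x ≠ 0) : Complex.exp (logCut x) = x := by
  rw [logCut, Complex.exp_add, Complex.exp_log (neg_ne_zero.2 hx), Complex.exp_pi_mul_I]
  ring

/-- `Re (logCut x) = log ‖x‖`. [folklore] -/
theorem logCut_re (x : ℂ) : (logCut x).re = Real.log ‖x‖ := by
  simp [logCut, Complex.log_re, norm_neg]

/-- `Im (logCut x) = arg (−x) + π`. [folklore] -/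
theorem logCut_im (x : ℂ) : (logCut x).im = Complex.arg (-x) + π := by
  simp [logCut, Complex.log_im]

/-- Off the cut, `Im (logCut x) ∈ (0, 2π)`. [folklore] -/
theorem logCut_im_mem {x : ℂ} (hx : -x ∈ Complex.slitPlane) : (logCut x).im ∈ Ioo 0 (2 * π) := by
  rw [logCut_im]
  have h1 := Complex.neg_pi_lt_arg (-x)
  have h2 : Complex.arg (-x) < π :=
    lt_of_le_of_ne (Complex.arg_le_pi _) (Complex.mem_slitPlane_iff_arg.1 hx).1
  constructor <;> linarith

/-- Points off the cut are non-zero. [folklore] -/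
theorem ne_zero_of_neg_mem_slitPlane {x : ℂ} (hx : -x ∈ Complex.slitPlane) : x ≠ 0 := fun h0 =>
  Complex.slitPlane_ne_zero hx (by rw [h0, neg_zero])

/-! ## §2 The radial profile -/

/-- **The radial profile** `radProfile s = χ(s − 3) · log s` (`χ` Mathlib's smooth transition): `0` for
`s ≤ 3`, `log s` for `s ≥ 4`. [folklore] -/
def radProfile (s : ℝ) : ℝ := Real.smoothTransition (s - 3) * Real.log s

/-- `radProfile s = 0` for `s ≤ 3`. [folklore] -/
theorem radProfile_of_le_three {s : ℝ} (hs : s ≤ 3) : radProfile s = 0 := by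
  rw [radProfile, Real.smoothTransition.zero_of_nonpos (by linarith), zero_mul]

/-- `radProfile s = log s` for `s ≥ 4`. [folklore] -/
theorem radProfile_of_four_le {s : ℝ} (hs : 4 ≤ s) : radProfile s = Real.log s := by
  rw [radProfile, Real.smoothTransition.one_of_one_le (by linarith), one_mul]

/-- `0 ≤ radProfile s` for `s ≥ 1`. [folklore] -/
theorem radProfile_nonneg {s : ℝ} (hs : 1 ≤ s) : 0 ≤ radProfile s :=
  mul_nonneg (Real.smoothTransition.nonneg _) (Real.log_nonneg hs)

/-- `0 ≤ radProfile s` for every `s` (it vanishes below `3`). [folklore] -/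
theorem radProfile_nonneg' (s : ℝ) : 0 ≤ radProfile s := by
  rcases le_or_gt s 3 with h | h
  · rw [radProfile_of_le_three h]
  · exact radProfile_nonneg (by linarith)

/-- `radProfile s ≤ log s` for `s ≥ 1`. [folklore] -/
theorem radProfile_le_log {s : ℝ} (hs : 1 ≤ s) : radProfile s ≤ Real.log s := by
  have h1 := Real.smoothTransition.le_one (s - 3)
  have hl := Real.log_nonneg hs
  unfold radProfile
  nlinarith

/-- `radProfile` is monotone on `[1, ∞)`. [folklore] -/
theorem radProfile_mono {s t : ℝ} (hs : 1 ≤ s) (hst : s ≤ t) : radProfile s ≤ radProfile t := by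
  unfold radProfile
  exact mul_le_mul (Real.smoothTransition.monotone (by linarith)) (Real.log_le_log (by linarith) hst)
    (Real.log_nonneg hs) (Real.smoothTransition.nonneg _)

/-- `radProfile` is monotone on `[0, ∞)`. [folklore] -/
theorem radProfile_mono' {s t : ℝ} (hst : s ≤ t) : radProfile s ≤ radProfile t := by
  rcases le_or_gt s 3 with h | h
  · rw [radProfile_of_le_three h]; exact radProfile_nonneg' t
  · exact radProfile_mono (by linarith) hst

/-! ## §3 The compressed power `stabX` -/

/-- The compression exponent `κ = (2g+1)/(2g+3)`. [cite: Milnor1968, §9] -/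
def kap (g : ℕ) : ℝ := (2 * g + 1) / (2 * g + 3)

/-- `0 < κ`. [folklore] -/
theorem kap_pos : 0 < kap g := by unfold kap; positivity

/-- `κ < 1`. [folklore] -/
theorem kap_lt_one : kap g < 1 := by
  unfold kap
  rw [div_lt_one (by positivity)]
  linarith

/-- `κ + 2/(2g+3) = 1`. [folklore] -/
theorem kap_add : kap g + 2 / (2 * g + 3) = 1 := by
  unfold kap
  field_simp
  ring

/-- The exponent `κ · logCut x + radProfile ‖x‖² / (2g+3)`. [cite: Milnor1968, §9] -/
def stabExpo (g : ℕ) (x : ℂ) : ℂ :=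
  (kap g : ℂ) * logCut x + ((radProfile (‖x‖ ^ 2) / (2 * g + 3) : ℝ) : ℂ)

/-- **The compressed, radially corrected power** `stabX g x = exp (κ logCut x + radProfile ‖x‖²/(2g+3))`
(`= x^{(2g+1)/(2g+3)}` for `‖x‖² ≤ 3`, of modulus `‖x‖` for `‖x‖² ≥ 4`). [cite: Milnor1968, §9] -/
def stabX (g : ℕ) (x : ℂ) : ℂ := Complex.exp (stabExpo g x)

/-- `stabX` never vanishes. [folklore] -/
theorem stabX_ne_zero (x : ℂ) : stabX g x ≠ 0 := Complex.exp_ne_zero _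

/-- `(2g+3) · exponent = (2g+1) logCut x + radProfile ‖x‖²`. [folklore] -/
theorem natMul_stabExpo (x : ℂ) :
    ((2 * g + 3 : ℕ) : ℂ) * stabExpo g x = ((2 * g + 1 : ℕ) : ℂ) * logCut x + (radProfile (‖x‖ ^ 2) : ℂ) := by
  have h3 : ((2 * g + 3 : ℝ) : ℂ) ≠ 0 := by
    have : (0 : ℝ) < 2 * g + 3 := by positivity
    exact_mod_cast this.ne'
  unfold stabExpo kap
  push_cast at h3 ⊢
  field_simp

/-- **`stabX ^ (2g+3) = e^{radProfile ‖x‖²} · x^{2g+1}`** (`x ≠ 0`). [cite: Milnor1968, §9] -/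
theorem stabX_pow {x : ℂ} (hx : x ≠ 0) :
    stabX g x ^ (2 * g + 3) = (Real.exp (radProfile (‖x‖ ^ 2)) : ℂ) * x ^ (2 * g + 1) := by
  rw [stabX, ← Complex.exp_nat_mul, natMul_stabExpo, Complex.exp_add, Complex.exp_nat_mul, exp_logCut hx,
    Complex.ofReal_exp]
  ring

/-- Real part of the exponent. [folklore] -/
theorem stabExpo_re (x : ℂ) :
    (stabExpo g x).re = kap g * Real.log ‖x‖ + radProfile (‖x‖ ^ 2) / (2 * g + 3) := by
  rw [stabExpo, Complex.add_re, Complex.ofReal_re, Complex.re_ofReal_mul, logCut_re]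

/-- Imaginary part of the exponent. [folklore] -/
theorem stabExpo_im (x : ℂ) : (stabExpo g x).im = kap g * (logCut x).im := by
  rw [stabExpo, Complex.add_im, Complex.ofReal_im, Complex.im_ofReal_mul, add_zero]

/-- **The modulus of `stabX`.** [folklore] -/
theorem norm_stabX (x : ℂ) :
    ‖stabX g x‖ = Real.exp (kap g * Real.log ‖x‖ + radProfile (‖x‖ ^ 2) / (2 * g + 3)) := by
  rw [stabX, Complex.norm_exp, stabExpo_re]

/-- **On the binding region `‖x‖² ≥ 4`, `‖stabX x‖ = ‖x‖`.** [folklore] -/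
theorem norm_stabX_of_four_le {x : ℂ} (hx : 4 ≤ ‖x‖ ^ 2) : ‖stabX g x‖ = ‖x‖ := by
  have hx0 : 0 < ‖x‖ := by nlinarith [norm_nonneg x]
  have h3 : (0 : ℝ) < 2 * g + 3 := by positivity
  rw [norm_stabX, radProfile_of_four_le hx, Real.log_pow, Nat.cast_ofNat]
  have e : kap g * Real.log ‖x‖ + 2 * Real.log ‖x‖ / (2 * g + 3) = (kap g + 2 / (2 * g + 3)) * Real.log ‖x‖ := by
    field_simp
  rw [e, kap_add, one_mul, Real.exp_log hx0]

/-- `‖stabX x‖ ≤ ‖x‖` for `‖x‖ ≥ 1`. [folklore] -/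
theorem norm_stabX_le {x : ℂ} (hx : 1 ≤ ‖x‖) : ‖stabX g x‖ ≤ ‖x‖ := by
  have hx0 : 0 < ‖x‖ := by linarith
  have h3 : (0 : ℝ) < 2 * g + 3 := by positivity
  have hs : 1 ≤ ‖x‖ ^ 2 := by nlinarith
  have h1 : radProfile (‖x‖ ^ 2) ≤ 2 * Real.log ‖x‖ := by
    have := radProfile_le_log hs
    rwa [Real.log_pow, Nat.cast_ofNat] at this
  rw [norm_stabX]
  calc Real.exp (kap g * Real.log ‖x‖ + radProfile (‖x‖ ^ 2) / (2 * g + 3))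
      ≤ Real.exp (kap g * Real.log ‖x‖ + 2 * Real.log ‖x‖ / (2 * g + 3)) := by
        gcongr
    _ = Real.exp ((kap g + 2 / (2 * g + 3)) * Real.log ‖x‖) := by congr 1; field_simp
    _ = ‖x‖ := by rw [kap_add, one_mul, Real.exp_log hx0]

/-- `‖stabX x‖ ≤ 1` for `‖x‖ ≤ 1`. [folklore] -/
theorem norm_stabX_le_one {x : ℂ} (hx : ‖x‖ ≤ 1) : ‖stabX g x‖ ≤ 1 := by
  rw [norm_stabX, radProfile_of_le_three (by nlinarith [norm_nonneg x] : ‖x‖ ^ 2 ≤ 3), zero_div, add_zero]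
  have hl : Real.log ‖x‖ ≤ 0 := Real.log_nonpos (norm_nonneg _) hx
  have : kap g * Real.log ‖x‖ ≤ 0 := mul_nonpos_of_nonneg_of_nonpos kap_pos.le hl
  calc Real.exp (kap g * Real.log ‖x‖) ≤ Real.exp 0 := Real.exp_le_exp.2 this
    _ = 1 := Real.exp_zero

/-- **In the flat region `‖x‖ < 2`, `‖stabX x‖ < 2`.** [folklore] -/
theorem norm_stabX_lt_two {x : ℂ} (hx : ‖x‖ < 2) : ‖stabX g x‖ < 2 := by
  rcases le_or_gt 1 ‖x‖ with h1 | h1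
  · exact (norm_stabX_le h1).trans_lt hx
  · exact (norm_stabX_le_one h1.le).trans_lt one_lt_two

/-- **The cut-off `eta` does not see the compression**: `eta ‖stabX x‖² = eta ‖x‖²`. [folklore] -/
theorem eta_norm_stabX_sq (x : ℂ) : eta (‖stabX g x‖ ^ 2) = eta (‖x‖ ^ 2) := by
  rcases le_or_gt 4 (‖x‖ ^ 2) with h | h
  · rw [norm_stabX_of_four_le h]
  · have hx : ‖x‖ < 2 := by nlinarith [norm_nonneg x]
    have h2 := norm_stabX_lt_two (g := g) hx
    rw [eta_of_le h.le, eta_of_le]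
    nlinarith [norm_nonneg (stabX g x)]

/-- **The modulus of `stabX` is strictly increasing in `‖x‖`** (`x ≠ 0`). [folklore] -/
theorem norm_stabX_lt_norm_stabX {x x' : ℂ} (hx : x ≠ 0) (h : ‖x‖ < ‖x'‖) : ‖stabX g x‖ < ‖stabX g x'‖ := by
  have hx0 : 0 < ‖x‖ := norm_pos_iff.2 hx
  have h3 : (0 : ℝ) < 2 * g + 3 := by positivity
  rw [norm_stabX, norm_stabX, Real.exp_lt_exp]
  have h1 : kap g * Real.log ‖x‖ < kap g * Real.log ‖x'‖ :=
    mul_lt_mul_of_pos_left (Real.log_lt_log hx0 h) kap_pos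
  have h2 : radProfile (‖x‖ ^ 2) / (2 * g + 3) ≤ radProfile (‖x'‖ ^ 2) / (2 * g + 3) :=
    div_le_div_of_nonneg_right (radProfile_mono' (by nlinarith [norm_nonneg x])) h3.le
  linarith

/-- Equal moduli of `stabX` force equal moduli (`x, x' ≠ 0`). [folklore] -/
theorem norm_eq_of_norm_stabX_eq {x x' : ℂ} (hx : x ≠ 0) (hx' : x' ≠ 0) (h : ‖stabX g x‖ = ‖stabX g x'‖) :
    ‖x‖ = ‖x'‖ := by
  rcases lt_trichotomy ‖x‖ ‖x'‖ with hl | he | hg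
  · exact absurd h (norm_stabX_lt_norm_stabX hx hl).ne
  · exact he
  · exact absurd h (norm_stabX_lt_norm_stabX hx' hg).ne'

/-- **`stabX` is injective off the cut.** [cite: Milnor1968, §9] -/
theorem stabX_injOn : InjOn (stabX g) {x | -x ∈ Complex.slitPlane} := by
  intro x hx x' hx' h
  have hx0 : x ≠ 0 := ne_zero_of_neg_mem_slitPlane hx
  have hx0' : x' ≠ 0 := ne_zero_of_neg_mem_slitPlane hx'
  have hn : ‖x‖ = ‖x'‖ := norm_eq_of_norm_stabX_eq hx0 hx0' (by rw [h])
  obtain ⟨n, hn'⟩ := Complex.exp_eq_exp_iff_exists_int.1 h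
  -- the imaginary parts pin `n = 0`
  have hn0 : n = 0 := by
    have e := congrArg Complex.im hn'
    simp only [Complex.add_im, stabExpo_im, Complex.mul_im, Complex.intCast_re, Complex.intCast_im,
      Complex.mul_re, Complex.re_ofNat, Complex.im_ofNat, Complex.ofReal_re, Complex.ofReal_im,
      Complex.I_re, Complex.I_im, mul_zero, zero_mul, sub_zero, add_zero, mul_one] at e
    obtain ⟨a1, a2⟩ := logCut_im_mem hx
    obtain ⟨b1, b2⟩ := logCut_im_mem hx'
    have hk := kap_pos (g := g)
    have hk1 := kap_lt_one (g := g)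
    have hpi := Real.pi_pos
    have hlt : (n : ℝ) * (2 * π) < 1 * (2 * π) := by nlinarith
    have hgt : (-1 : ℝ) * (2 * π) < (n : ℝ) * (2 * π) := by nlinarith
    have h1 : (n : ℝ) < 1 := lt_of_mul_lt_mul_right hlt (by positivity)
    have h2 : (-1 : ℝ) < n := lt_of_mul_lt_mul_right hgt (by positivity)
    have h1' : n < 1 := by exact_mod_cast h1
    have h2' : -1 < n := by exact_mod_cast h2
    omega
  rw [hn0] at hn'
  simp only [Int.cast_zero, zero_mul, add_zero] at hn'
  have e : (kap g : ℂ) * logCut x = (kap g : ℂ) * logCut x' := by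
    unfold stabExpo at hn'
    rw [hn] at hn'
    exact add_right_cancel hn'
  have hk : (kap g : ℂ) ≠ 0 := by exact_mod_cast kap_pos.ne'
  have e2 : logCut x = logCut x' := mul_left_cancel₀ hk e
  have e3 : Complex.log (-x) = Complex.log (-x') := add_right_cancel e2
  have e4 := congrArg Complex.exp e3
  rw [Complex.exp_log (neg_ne_zero.2 hx0), Complex.exp_log (neg_ne_zero.2 hx0')] at e4
  exact neg_inj.1 e4

end StabBase

/-! ## Registered helper -/

/-- **Registered helper `helper_norm_stabX` (sub-goal of `stub_STgeo` ▸ N3-nat ▸ N3d-1 ▸ G1a/G1b, wave 8,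
lead c5): on the binding region `‖x‖² ≥ 4` the compressed power has the modulus of `x`, and for `x ≠ 0` its
`(2g+3)`-rd power is `e^{radProfile ‖x‖²} · x^{2g+1}`.** [cite: Milnor1968, §9] -/
theorem helper_norm_stabX : ∀ (g : ℕ) (x : ℂ), x ≠ 0 → Summit.SmoothPoincare4.SmoothPoincare4.Theorems.AcyclicBisectionExists.ModpBraidOrbits.StabBase.stabX g x ^ (2 * g + 3) = (Real.exp (Summit.SmoothPoincare4.SmoothPoincare4.Theorems.AcyclicBisectionExists.ModpBraidOrbits.StabBase.radProfile (‖x‖ ^ 2)) : ℂ) * x ^ (2 * g + 1) ∧ (4 ≤ ‖x‖ ^ 2 → ‖Summit.SmoothPoincare4.SmoothPoincare4.Theorems.AcyclicBisectionExists.ModpBraidOrbits.StabBase.stabX g x‖ = ‖x‖) :=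
  fun _ _ hx => ⟨StabBase.stabX_pow hx, fun h4 => StabBase.norm_stabX_of_four_le h4⟩

end Summit.SmoothPoincare4.SmoothPoincare4.Theorems.AcyclicBisectionExists.ModpBraidOrbits

end
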